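import Summits.Parity.GeneralizedHardyLittlewood.Theorems.GoldbachHeathBrownDispersionHeathBrownMorozUniformClassTypeII
import Literature.NumberTheory.Sieve.HeathBrownMorozClassUpperBounds
import HarnessLib

/-!
# Crux `HeathBrownMorozUniform` (stmt-Parity-19915): the class sieve comparison and the class asymptotic, η-band form

Helper (`--supports stmt-Parity-19915`), sequel of `…HeathBrownMorozUniformClassTypeII`.  For the class family
`classPairs X η d a b` with comparison constant `κ_d = (w(d)/d²)κ` (`HeathBrownMorozClassFamily`) this file
proves, from the class Fundamental-Lemma comparison (HBM04 Lemma 3.1 = [HeathBrownActa2001, Lemma 3.5] for the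
class; hypothesis `h35`, a stub of the campaign) and the class Type II block (hypothesis `hII`, the OUTPUT shape
of `classTypeII_terms_band`):

* `classSieveComparison_band` — HBM04 (3.2): `|π(𝒜_cl) − κ_d π(ℬ)| ≤ C η²X²(log X)^{-1}(log log X)^{-1/6}` for
  every `c ≥ c₀`, `K_b ≥ 1`, `X ≥ X₀(c, K_b)` and every `η` in the band `(log X)^{-c} ≤ η ≤ K_b(log X)^{-c}`
  (Lemma 3.4 for the class = `HeathBrownMoroz2004_lemma_3_4`, Lemma 3.6 for the class =
  `HeathBrownMoroz2004_lemma_3_2`, both theorems of the tree; bookkeeping = `HeathBrown2001_sieveComparison_at`);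
* `eventually_abs_normPrimeCount_sub_le_band` — (2.3) in the band: `|π(ℬ)(X, η) − ηX³/log X| ≤ 2ηX³/(log X)²`
  for all `η ∈ [(log X)^{-c}, 1]` (the tree's `eventually_abs_normPrimeCount_sub_le` has `η = (log X)^{-c}`);
* `classAsymptotic_band` — `|π(𝒜_cl)(X, η) − (w(d)/d²)·σ₀η²X²/(3 log X)| ≤ C η²X²(log X)^{-1}(log log X)^{-1/6}`
  in the band, for every `c ≥ c₀`, with `σ₀` the singular series (HBM04 Theorem 2 in Heath-Brown's frame,
  modulo the stubs).

References: [cite: HeathBrownMoroz2004, §3 (3.2)]; [cite: HeathBrownActa2001, §2 pp. 4–5 and §3 (3.15)].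
Tree: `HeathBrownMoroz2004_lemma_3_4`, `HeathBrownMoroz2004_lemma_3_2`, `classKappa_le`, `classKappa_def`,
`eventually_params`, `sqrt_window_le`, `abs_offsetLogIntegral_window_sub_le`, `tendsto_exp_neg_mul_sqrt_mul_rpow`,
`HeathBrown2001_firstDegreePIT_holds`, `normPrimeCount_eq_sub`, `HeathBrown2001_singularProduct_holds`,
`eventually_band_params`.
-/

noncomputable section

open Polynomial NumberField Finset Filter Topology Asymptotics

namespace Summit.Parity.GeneralizedHardyLittlewood.Theorems.GoldbachHeathBrownDispersionHeathBrownMorozUniform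

open Literature.NumberTheory.Sieve.CubicSieve Literature.NumberTheory.Sieve.CubicPrimes
open Literature.NumberTheory.LFunctions.CubeRootTwoField

set_option maxHeartbeats 400000 in
/-- **The class sieve comparison (HBM04 (3.2)), every large exponent, η-band form**, from the class
Fundamental-Lemma comparison `h35` and the class Type II block `hII` (output of `classTypeII_terms_band`):
`|π(𝒜_cl) − κ_d π(ℬ)| ≤ C·η²X²(log X)^{-1}(log log X)^{-1/6}` for `X ≥ X₀`, `(log X)^{-c} ≤ η ≤ K_b(log X)^{-c}`.
[cite: HeathBrownMoroz2004, §3 (3.2)] -/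
theorem classSieveComparison_band (d a b : ℕ) (hd : 1 ≤ d)
    (h35 : ∀ σ₀ : ℝ, Tendsto singularProductPartial atTop (𝓝 σ₀) → ∀ ϖ : ℝ, 0 < ϖ → ϖ < 1 / 5 →
      ∃ C X₀ : ℝ, ∀ X η : ℝ, X₀ ≤ X → Real.exp (-Real.log X ^ (1 / 3 : ℝ)) ≤ η → η ≤ 1 →
        ∑ n ∈ range (chainBound (hbTau ϖ X) + 1),
            |(Tpiece (classPairs X η d a b) pairIdeal X (hbTau ϖ X) n : ℝ) -
                classKappa σ₀ X η d * Tpiece (normWindow X η) (fun J => J) X (hbTau ϖ X) n| ≤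
          C * hbTau ϖ X * η ^ 2 * X ^ 2 / Real.log X)
    (hII : ∀ σ₀ : ℝ, Tendsto singularProductPartial atTop (𝓝 σ₀) →
      ∃ c₀ : ℝ, 0 < c₀ ∧ ∀ c : ℝ, c₀ ≤ c → ∀ Kb : ℝ, 1 ≤ Kb → ∃ C X₀ : ℝ, ∀ X η : ℝ, X₀ ≤ X →
        Real.log X ^ (-c) ≤ η → η ≤ Kb * Real.log X ^ (-c) →
        |(U1piece (classPairs X η d a b) pairIdeal X (hbTau (1 / 6) X) 1 : ℝ) -
            classKappa σ₀ X η d * U1piece (normWindow X η) (fun J => J) X (hbTau (1 / 6) X) 1|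
        + |(U1piece (classPairs X η d a b) pairIdeal X (hbTau (1 / 6) X) 2 : ℝ) -
            classKappa σ₀ X η d * U1piece (normWindow X η) (fun J => J) X (hbTau (1 / 6) X) 2|
        + ∑ n ∈ Icc 3 (chainBound (hbTau (1 / 6) X)),
            |(Upiece (classPairs X η d a b) pairIdeal X (hbTau (1 / 6) X) n : ℝ) -
              classKappa σ₀ X η d * Upiece (normWindow X η) (fun J => J) X (hbTau (1 / 6) X) n|
        + |(U2one (classPairs X η d a b) pairIdeal X (hbTau (1 / 6) X) : ℝ) -
            classKappa σ₀ X η d * U2one (normWindow X η) (fun J => J) X (hbTau (1 / 6) X)|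
        + |(S₄ (classPairs X η d a b) pairIdeal X (hbTau (1 / 6) X) : ℝ) -
            classKappa σ₀ X η d * S₄ (normWindow X η) (fun J => J) X (hbTau (1 / 6) X)| ≤
          C * hbTau (1 / 6) X * η ^ 2 * X ^ 2 / Real.log X) :
    ∀ σ₀ : ℝ, Tendsto singularProductPartial atTop (𝓝 σ₀) →
      ∃ c₀ : ℝ, 0 < c₀ ∧ ∀ c : ℝ, c₀ ≤ c → ∀ Kb : ℝ, 1 ≤ Kb → ∃ C X₀ : ℝ, ∀ X η : ℝ, X₀ ≤ X →
        Real.log X ^ (-c) ≤ η → η ≤ Kb * Real.log X ^ (-c) →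
        |(classPrimeCount X η d a b : ℝ) - classKappa σ₀ X η d * normPrimeCount X η| ≤
          C * (η ^ 2 * X ^ 2 / Real.log X * Real.log (Real.log X) ^ (-(1 / 6 : ℝ))) := by
  intro σ₀ hσ
  have hσ0 : 0 ≤ σ₀ := ge_of_tendsto' hσ fun N => (singularProductPartial_pos N).le
  obtain ⟨c₀, hc₀, HII⟩ := hII σ₀ hσ
  refine ⟨c₀, hc₀, fun c hc Kb hKb => ?_⟩
  have hcpos : 0 < c := hc₀.trans_le hc
  obtain ⟨CII, XII, hIIb⟩ := HII c hc Kb hKb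
  obtain ⟨C5, X5, h5⟩ := h35 σ₀ hσ (1 / 6) (by norm_num) (by norm_num)
  obtain ⟨C6, X6, h6⟩ := HeathBrownMoroz2004_lemma_3_2 σ₀ hσ (1 / 6) (by norm_num) (by norm_num)
    (classWeight d) (classWeight_pos d).le
  set w := classWeight d with hw
  have hwpos : 0 < w := classWeight_pos d
  obtain ⟨X₀, hX₀⟩ := eventually_atTop.mp ((eventually_params hcpos (3 * w * σ₀)).and
    ((eventually_band_params hcpos Kb d).and ((eventually_ge_atTop X5).and ((eventually_ge_atTop X6).and
      (eventually_ge_atTop XII)))))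
  refine ⟨1 + |C5| + 4 * |C6| + |CII|, X₀, fun X η hX hηlo hηhi => ?_⟩
  obtain ⟨⟨hX2, hη00, -, hηexp, hτ0, hτ4, hfirst⟩, ⟨hK10, -⟩, hX5, hX6, hXII⟩ := hX₀ X hX
  set L := Real.log X with hL
  set η₀ := L ^ (-c) with hη₀
  set τ := hbTau (1 / 6) X with hτdef
  set κ := classKappa σ₀ X η d with hκ
  have hX0 : 0 < X := by linarith
  have hX1 : 1 ≤ X := by linarith
  have hLpos : 0 < L := Real.log_pos (by linarith)
  have hη0 : 0 < η := lt_of_lt_of_le hη00 hηlo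
  have hη10 : η ≤ 1 / 10 := hηhi.trans hK10
  have hη1 : η ≤ 1 := by linarith
  have hηexp' : Real.exp (-L ^ (1 / 3 : ℝ)) ≤ η := hηexp.trans hηlo
  obtain ⟨hκ0, hκw⟩ := classKappa_le hσ0 hX0.le hη0.le hd (σ₀ := σ₀) (X := X) (η := η)
  have h34 := HeathBrownMoroz2004_lemma_3_4 (κ := κ) hX2 hη0.le hη10 hτ0 hτ4 hκ0 d a b
  have h5X := h5 X η hX5 hηexp' hη1
  obtain ⟨h63, h65, h66, h67⟩ := h6 X η hX6 hηexp' hη1 (classPairs X η d a b)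
    (classPairs_subset_boxPairs X η d a b) κ hκ0 hκw
  have hIIX := hIIb X η hXII hηlo hηhi
  set B := τ * η ^ 2 * X ^ 2 / L with hB
  have hB0 : 0 ≤ B := by rw [hB]; positivity
  -- the first term: `κ_d·3(√(3X³(1+η)) + 1) ≤ 3wσ₀ηX^{1/2} ≤ τη²X²/L`
  have hfirst' : κ * (3 * (Real.sqrt (3 * X ^ 3 * (1 + η)) + 1)) ≤ B := by
    have hsq := sqrt_window_le hX0.le (by linarith : η ≤ 1 / 3)
    have hX12 : 0 < X ^ (1 / 2 : ℝ) := Real.rpow_pos_of_pos hX0 _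
    have hX32 : X ^ (3 / 2 : ℝ) = X * X ^ (1 / 2 : ℝ) := by
      rw [← Real.rpow_one_add' hX0.le (by norm_num)]; norm_num
    have hX12ge : 1 ≤ X ^ (1 / 2 : ℝ) := Real.one_le_rpow hX1 (by norm_num)
    have h1 : Real.sqrt (3 * X ^ 3 * (1 + η)) + 1 ≤ 3 * X * X ^ (1 / 2 : ℝ) := by
      rw [hX32] at hsq; nlinarith
    have hκ' : κ ≤ w * (σ₀ * η / (3 * X)) := by rw [hκ]; rwa [kappa_def] at hκw
    -- from `3wσ₀·η₀X^{1/2} ≤ τη₀²X²/L`: `3wσ₀ X^{1/2} ≤ τ η₀ X²/L ≤ τ η X²/L`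
    have hf2 : 3 * w * σ₀ * X ^ (1 / 2 : ℝ) ≤ τ * η * X ^ 2 / L := by
      have h := hfirst
      have e : hbTau (1 / 6) X * (L ^ (-c)) ^ 2 * X ^ 2 / Real.log X = (τ * η₀ * X ^ 2 / L) * η₀ := by
        rw [hτdef, hη₀, hL]; ring
      rw [e, show 3 * w * σ₀ * L ^ (-c) * X ^ (1 / 2 : ℝ) = (3 * w * σ₀ * X ^ (1 / 2 : ℝ)) * η₀ by
        rw [hη₀]; ring] at h
      have h' : 3 * w * σ₀ * X ^ (1 / 2 : ℝ) ≤ τ * η₀ * X ^ 2 / L := le_of_mul_le_mul_right h hη00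
      calc 3 * w * σ₀ * X ^ (1 / 2 : ℝ) ≤ τ * η₀ * X ^ 2 / L := h'
        _ ≤ τ * η * X ^ 2 / L := by gcongr
    calc κ * (3 * (Real.sqrt (3 * X ^ 3 * (1 + η)) + 1))
        ≤ (w * (σ₀ * η / (3 * X))) * (3 * (3 * X * X ^ (1 / 2 : ℝ))) := by
          refine mul_le_mul hκ' (by linarith) (by positivity) (by positivity)
      _ = (3 * w * σ₀ * X ^ (1 / 2 : ℝ)) * η := by field_simp
      _ ≤ (τ * η * X ^ 2 / L) * η := mul_le_mul_of_nonneg_right hf2 hη0.le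
      _ = B := by rw [hB]; ring
  have h5' := h5X.trans (by
    show C5 * τ * η ^ 2 * X ^ 2 / L ≤ |C5| * B
    rw [hB, show C5 * τ * η ^ 2 * X ^ 2 / L = C5 * (τ * η ^ 2 * X ^ 2 / L) by ring]
    exact mul_le_mul_of_nonneg_right (le_abs_self _) hB0)
  have hC6B : C6 * τ * η ^ 2 * X ^ 2 / L ≤ |C6| * B := by
    rw [hB, show C6 * τ * η ^ 2 * X ^ 2 / L = C6 * (τ * η ^ 2 * X ^ 2 / L) by ring]
    exact mul_le_mul_of_nonneg_right (le_abs_self _) hB0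
  have hII' := hIIX.trans (by
    show CII * τ * η ^ 2 * X ^ 2 / L ≤ |CII| * B
    rw [hB, show CII * τ * η ^ 2 * X ^ 2 / L = CII * (τ * η ^ 2 * X ^ 2 / L) by ring]
    exact mul_le_mul_of_nonneg_right (le_abs_self _) hB0)
  have h63' := h63.trans hC6B
  have h65' := h65.trans hC6B
  have h66' := h66.trans hC6B
  have h67' := h67.trans hC6B
  have hg : η ^ 2 * X ^ 2 / L * Real.log L ^ (-(1 / 6 : ℝ)) = B := by
    rw [hB, hτdef, hbTau, ← hL]; ring
  rw [hg]
  refine h34.trans ?_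
  linarith [hfirst', h5', h63', h65', h66', h67', hII']

/-- **(2.3) in the η-band**: for any real `c`, eventually in `X`, for every `η` with `(log X)^{-c} ≤ η ≤ 1`,
`|π(ℬ)(X, η) − ηX³/log X| ≤ 2ηX³/(log X)²` (the tree's `eventually_abs_normPrimeCount_sub_le` with `η` free:
the `Li`-window bound holds for every `0 < η ≤ 1` and the prime-ideal-theorem error `12C X³e^{-c'√log X}` is
`≤ (log X)^{-c}X³/(log X)² ≤ ηX³/(log X)²`). [cite: HeathBrownActa2001, §2 p. 5] -/
theorem eventually_abs_normPrimeCount_sub_le_band (c : ℝ) :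
    ∀ᶠ X : ℝ in atTop, ∀ η : ℝ, Real.log X ^ (-c) ≤ η → η ≤ 1 →
      |(normPrimeCount X η : ℝ) - η * X ^ 3 / Real.log X| ≤ 2 * (η * X ^ 3 / Real.log X ^ 2) := by
  obtain ⟨c', hc', C, hC⟩ := HeathBrown2001_firstDegreePIT_holds
  set C' := max C 0 with hC'
  have hC'0 : 0 ≤ C' := le_max_right _ _
  have hC1 : ∀ x : ℝ, 2 ≤ x → |(firstDegreePrimeCount x : ℝ) - Literature.NumberTheory.LFunctions.offsetLogIntegral x| ≤
      C' * x * Real.exp (-c' * Real.sqrt (Real.log x)) := fun x hx =>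
    (hC x hx).trans (by gcongr; exact le_max_left _ _)
  have hpos : (0 : ℝ) < 1 / (12 * C' + 1) := by positivity
  have hev : ∀ᶠ L : ℝ in atTop, Real.exp (-c' * Real.sqrt L) * L ^ (c + 2) ≤ 1 / (12 * C' + 1) :=
    (tendsto_exp_neg_mul_sqrt_mul_rpow hc' (c + 2)).eventually (ge_mem_nhds hpos)
  filter_upwards [Real.tendsto_log_atTop.eventually hev, eventually_ge_atTop (2 : ℝ),
    Real.tendsto_log_atTop.eventually (eventually_ge_atTop (1 : ℝ))] with X hXev hX2 hL1 η hηlo hη1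
  set L := Real.log X with hL
  set η₀ := L ^ (-c) with hη₀
  have hX0 : 0 < X := by linarith
  have hX1 : 1 < X := by linarith
  have hLpos : 0 < L := by linarith
  have hη00 : 0 < η₀ := Real.rpow_pos_of_pos hLpos _
  have hη0 : 0 < η := lt_of_lt_of_le hη00 hηlo
  have hX3pos : 0 < X ^ 3 := pow_pos hX0 3
  set a := 3 * X ^ 3 with ha
  set b := 3 * X ^ 3 * (1 + η) with hb
  have hXX3 : X ≤ X ^ 3 := le_self_pow₀ hX1.le three_ne_zero
  have ha2 : 2 ≤ a := by rw [ha]; nlinarith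
  have hab : a ≤ b := by rw [hb, ha]; nlinarith
  have hb2 : 2 ≤ b := ha2.trans hab
  have hb6 : b ≤ 6 * X ^ 3 := by rw [hb]; nlinarith
  have hLi := abs_offsetLogIntegral_window_sub_le hX2 hη0 hη1
  have hexp_mono : ∀ y : ℝ, a ≤ y → Real.exp (-c' * Real.sqrt (Real.log y)) ≤
      Real.exp (-c' * Real.sqrt L) := by
    intro y hy
    have hXy : X ≤ y := by rw [ha] at hy; nlinarith
    apply Real.exp_le_exp.2
    have := Real.sqrt_le_sqrt (Real.log_le_log hX0 hXy)
    nlinarith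
  have hEb : |(firstDegreePrimeCount b : ℝ) - Literature.NumberTheory.LFunctions.offsetLogIntegral b| ≤
      6 * C' * X ^ 3 * Real.exp (-c' * Real.sqrt L) := by
    refine (hC1 b hb2).trans ?_
    calc C' * b * Real.exp (-c' * Real.sqrt (Real.log b))
        ≤ C' * (6 * X ^ 3) * Real.exp (-c' * Real.sqrt L) :=
          mul_le_mul (mul_le_mul_of_nonneg_left hb6 hC'0) (hexp_mono b hab) (Real.exp_pos _).le
            (by positivity)
      _ = 6 * C' * X ^ 3 * Real.exp (-c' * Real.sqrt L) := by ring
  have hEa : |(firstDegreePrimeCount a : ℝ) - Literature.NumberTheory.LFunctions.offsetLogIntegral a| ≤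
      6 * C' * X ^ 3 * Real.exp (-c' * Real.sqrt L) := by
    refine (hC1 a ha2).trans ?_
    calc C' * a * Real.exp (-c' * Real.sqrt (Real.log a))
        ≤ C' * (6 * X ^ 3) * Real.exp (-c' * Real.sqrt L) :=
          mul_le_mul (mul_le_mul_of_nonneg_left (hab.trans hb6) hC'0) (hexp_mono a le_rfl)
            (Real.exp_pos _).le (by positivity)
      _ = 6 * C' * X ^ 3 * Real.exp (-c' * Real.sqrt L) := by ring
  have hE : 12 * C' * X ^ 3 * Real.exp (-c' * Real.sqrt L) ≤ η * X ^ 3 / L ^ 2 := by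
    have hLc : 0 < L ^ (c + 2) := Real.rpow_pos_of_pos hLpos _
    have hηL : η₀ / L ^ 2 = (L ^ (c + 2))⁻¹ := by
      rw [hη₀, Real.rpow_neg hLpos.le, Real.rpow_add hLpos, Real.rpow_two, mul_inv, div_eq_mul_inv]
    have h1 : 12 * C' * Real.exp (-c' * Real.sqrt L) ≤ (L ^ (c + 2))⁻¹ := by
      rw [inv_eq_one_div, le_div_iff₀ hLc]
      calc 12 * C' * Real.exp (-c' * Real.sqrt L) * L ^ (c + 2)
          = 12 * C' * (Real.exp (-c' * Real.sqrt L) * L ^ (c + 2)) := by ring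
        _ ≤ 12 * C' * (1 / (12 * C' + 1)) := by gcongr
        _ ≤ 1 := by rw [mul_one_div, div_le_one (by positivity)]; linarith
    calc 12 * C' * X ^ 3 * Real.exp (-c' * Real.sqrt L)
        = (12 * C' * Real.exp (-c' * Real.sqrt L)) * X ^ 3 := by ring
      _ ≤ (L ^ (c + 2))⁻¹ * X ^ 3 := by gcongr
      _ = η₀ * X ^ 3 / L ^ 2 := by rw [← hηL]; ring
      _ ≤ η * X ^ 3 / L ^ 2 := by gcongr
  rw [normPrimeCount_eq_sub hX0.le hη0.le]
  have key : |(firstDegreePrimeCount b : ℝ) - firstDegreePrimeCount a - η * X ^ 3 / L| ≤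
      |Literature.NumberTheory.LFunctions.offsetLogIntegral b - Literature.NumberTheory.LFunctions.offsetLogIntegral a - η * X ^ 3 / L| +
        |(firstDegreePrimeCount b : ℝ) - Literature.NumberTheory.LFunctions.offsetLogIntegral b| +
        |(firstDegreePrimeCount a : ℝ) - Literature.NumberTheory.LFunctions.offsetLogIntegral a| := by
    have e : (firstDegreePrimeCount b : ℝ) - firstDegreePrimeCount a - η * X ^ 3 / L =
        (Literature.NumberTheory.LFunctions.offsetLogIntegral b - Literature.NumberTheory.LFunctions.offsetLogIntegral a - η * X ^ 3 / L) +
          ((firstDegreePrimeCount b : ℝ) - Literature.NumberTheory.LFunctions.offsetLogIntegral b) -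
          ((firstDegreePrimeCount a : ℝ) - Literature.NumberTheory.LFunctions.offsetLogIntegral a) := by ring
    rw [e]
    exact (abs_sub _ _).trans (add_le_add (abs_add_le _ _) le_rfl)
  calc |(firstDegreePrimeCount b : ℝ) - firstDegreePrimeCount a - η * X ^ 3 / L|
      ≤ η * X ^ 3 / L ^ 2 + 6 * C' * X ^ 3 * Real.exp (-c' * Real.sqrt L) +
          6 * C' * X ^ 3 * Real.exp (-c' * Real.sqrt L) := by
        refine key.trans (add_le_add (add_le_add hLi hEb) hEa)
    _ ≤ 2 * (η * X ^ 3 / L ^ 2) := by linarith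

/-- **The class asymptotic in Heath-Brown's frame, every large exponent, η-band form** (HBM04 Theorem 2
modulo the stubs `h35`, `hII`): there are `c₀ > 0` and the singular series `σ₀ > 0` such that for every
`c ≥ c₀`, `K_b ≥ 1` there are `C, X₀` with
`|π(𝒜_cl)(X, η) − (w(d)/d²)·σ₀η²X²/(3 log X)| ≤ C·η²X²(log X)^{-1}(log log X)^{-1/6}` for `X ≥ X₀` and
`(log X)^{-c} ≤ η ≤ K_b(log X)^{-c}` (`κ_d·ηX³/log X = (w(d)/d²)σ₀η²X²/(3 log X)` exactly).
[cite: HeathBrownMoroz2004, Theorem 2] -/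
theorem classAsymptotic_band (d a b : ℕ) (hd : 1 ≤ d)
    (hcmp : ∀ σ₀ : ℝ, Tendsto singularProductPartial atTop (𝓝 σ₀) →
      ∃ c₀ : ℝ, 0 < c₀ ∧ ∀ c : ℝ, c₀ ≤ c → ∀ Kb : ℝ, 1 ≤ Kb → ∃ C X₀ : ℝ, ∀ X η : ℝ, X₀ ≤ X →
        Real.log X ^ (-c) ≤ η → η ≤ Kb * Real.log X ^ (-c) →
        |(classPrimeCount X η d a b : ℝ) - classKappa σ₀ X η d * normPrimeCount X η| ≤
          C * (η ^ 2 * X ^ 2 / Real.log X * Real.log (Real.log X) ^ (-(1 / 6 : ℝ)))) :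
    ∃ c₀ : ℝ, 0 < c₀ ∧ ∃ σ₀ : ℝ, 0 < σ₀ ∧ Tendsto singularProductPartial atTop (𝓝 σ₀) ∧
      ∀ c : ℝ, c₀ ≤ c → ∀ Kb : ℝ, 1 ≤ Kb → ∃ C X₀ : ℝ, ∀ X η : ℝ, X₀ ≤ X →
        Real.log X ^ (-c) ≤ η → η ≤ Kb * Real.log X ^ (-c) →
        |(classPrimeCount X η d a b : ℝ) -
            classWeight d / (d : ℝ) ^ 2 * (σ₀ * η ^ 2 * X ^ 2 / (3 * Real.log X))| ≤
          C * (η ^ 2 * X ^ 2 / Real.log X * Real.log (Real.log X) ^ (-(1 / 6 : ℝ))) := by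
  obtain ⟨σ₀, hσ₀, hlim⟩ := HeathBrown2001_singularProduct_holds
  obtain ⟨c₀, hc₀, H⟩ := hcmp σ₀ hlim
  refine ⟨c₀, hc₀, σ₀, hσ₀, hlim, fun c hc Kb hKb => ?_⟩
  have hcpos : 0 < c := hc₀.trans_le hc
  obtain ⟨C, X₀, hCX⟩ := H c hc Kb hKb
  set w := classWeight d with hw
  have hwpos : 0 < w := classWeight_pos d
  obtain ⟨X₁, hX₁⟩ := eventually_atTop.mp ((eventually_abs_normPrimeCount_sub_le_band c).and
    ((eventually_band_params hcpos Kb d).and ((eventually_ge_atTop X₀).and ((eventually_ge_atTop (2 : ℝ)).and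
      ((Real.tendsto_log_atTop.eventually (eventually_ge_atTop (1 : ℝ))).and
      ((Real.tendsto_log_atTop.comp Real.tendsto_log_atTop).eventually (eventually_ge_atTop (1 : ℝ))))))))
  refine ⟨C + w * σ₀, X₁, fun X η hX hηlo hηhi => ?_⟩
  obtain ⟨hPIT, ⟨hK10, -⟩, hX0', hX2, hL1, hLL1⟩ := hX₁ X hX
  set L := Real.log X with hL
  set ℓ := Real.log L ^ (-(1 / 6 : ℝ)) with hℓ
  have hLL1' : 1 ≤ Real.log L := by simpa [Function.comp_def] using hLL1
  have hX0 : 0 < X := by linarith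
  have hLpos : 0 < L := by linarith
  have hη00 : 0 < L ^ (-c) := Real.rpow_pos_of_pos hLpos _
  have hη0 : 0 < η := lt_of_lt_of_le hη00 hηlo
  have hη1 : η ≤ 1 := by linarith [hηhi.trans hK10]
  have hℓ0 : 0 < ℓ := Real.rpow_pos_of_pos (by linarith) _
  have hLℓ : L⁻¹ ≤ ℓ := by
    rw [hℓ, Real.rpow_neg (by linarith)]
    refine inv_anti₀ (Real.rpow_pos_of_pos (by linarith) _) ?_
    calc Real.log L ^ (1 / 6 : ℝ) ≤ Real.log L ^ (1 : ℝ) :=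
          Real.rpow_le_rpow_of_exponent_le hLL1' (by norm_num)
      _ = Real.log L := Real.rpow_one _
      _ ≤ L := Real.log_le_self hLpos.le
  have hmain := hCX X η hX0' hηlo hηhi
  have hB := hPIT η hηlo hη1
  set κ := classKappa σ₀ X η d with hκ
  have hκ0 : 0 ≤ κ := by rw [hκ]; exact classKappa_nonneg hσ₀.le hX0.le hη0.le d
  have hκM : κ * (η * X ^ 3 / L) = w / (d : ℝ) ^ 2 * (σ₀ * η ^ 2 * X ^ 2 / (3 * L)) := by
    rw [hκ, classKappa_def, kappa_def, hw]; field_simp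
  have hκ2 : κ * (2 * (η * X ^ 3 / L ^ 2)) ≤ w * σ₀ * (η ^ 2 * X ^ 2 / L * ℓ) := by
    have hd1 : (1 : ℝ) ≤ (d : ℝ) ^ 2 := one_le_pow₀ (by exact_mod_cast hd)
    have e : κ * (2 * (η * X ^ 3 / L ^ 2)) = (2 / 3) * (w / (d : ℝ) ^ 2) * σ₀ * (η ^ 2 * X ^ 2 / L * L⁻¹) := by
      rw [hκ, classKappa_def, kappa_def, hw]; field_simp
    rw [e]
    have h1 : w / (d : ℝ) ^ 2 ≤ w := div_le_self hwpos.le hd1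
    have h2 : η ^ 2 * X ^ 2 / L * L⁻¹ ≤ η ^ 2 * X ^ 2 / L * ℓ :=
      mul_le_mul_of_nonneg_left hLℓ (by positivity)
    have h0 : 0 ≤ η ^ 2 * X ^ 2 / L * L⁻¹ := by positivity
    calc (2 / 3) * (w / (d : ℝ) ^ 2) * σ₀ * (η ^ 2 * X ^ 2 / L * L⁻¹)
        ≤ 1 * w * σ₀ * (η ^ 2 * X ^ 2 / L * ℓ) := by
          refine mul_le_mul (mul_le_mul (mul_le_mul (by norm_num) h1 (by positivity) zero_le_one) le_rfl
            hσ₀.le (by positivity)) h2 h0 (by positivity)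
      _ = w * σ₀ * (η ^ 2 * X ^ 2 / L * ℓ) := by ring
  have hdec : (classPrimeCount X η d a b : ℝ) - w / (d : ℝ) ^ 2 * (σ₀ * η ^ 2 * X ^ 2 / (3 * L)) =
      ((classPrimeCount X η d a b : ℝ) - κ * normPrimeCount X η) +
        κ * ((normPrimeCount X η : ℝ) - η * X ^ 3 / L) := by
    rw [mul_sub, hκM]; ring
  rw [hdec]
  calc |((classPrimeCount X η d a b : ℝ) - κ * normPrimeCount X η) +
          κ * ((normPrimeCount X η : ℝ) - η * X ^ 3 / L)|
      ≤ |(classPrimeCount X η d a b : ℝ) - κ * normPrimeCount X η| +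
          κ * |(normPrimeCount X η : ℝ) - η * X ^ 3 / L| := by
        refine (abs_add_le _ _).trans (add_le_add le_rfl ?_)
        rw [abs_mul, abs_of_nonneg hκ0]
    _ ≤ C * (η ^ 2 * X ^ 2 / L * ℓ) + κ * (2 * (η * X ^ 3 / L ^ 2)) := by gcongr
    _ ≤ C * (η ^ 2 * X ^ 2 / L * ℓ) + w * σ₀ * (η ^ 2 * X ^ 2 / L * ℓ) := by linarith
    _ = (C + w * σ₀) * (η ^ 2 * X ^ 2 / L * ℓ) := by ring

end Summit.Parity.GeneralizedHardyLittlewood.Theorems.GoldbachHeathBrownDispersionHeathBrownMorozUniform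

end
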